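import Summits.PneNP.PneNP.Theses.ForcedSplits
import Summits.PneNP.PneNP.Theorems.ExpanderLinearGeneratorsRandomKCNF
import Literature.Computability.MetaComplexity.RandomScopes
import Literature.Computability.MetaComplexity.RandomCNFFirstMoment
import Literature.Computability.Complexity.ClayProblemProofs
import Literature.Computability.Cryptography.CommitmentsSignatures

/-!
# Route ForcedSplits — probability and complexity glue (helper for `Sandwich`, stmt-PneNP-8179)

* `forcedSplits_toOuterMeasure_compl` — `Pr[sᶜ] = 1 - Pr[s]` for a `PMF`;
* `forcedSplits_flow_marginal` — events of the UP-guided flow depending only on the root have the probability of the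
  root ensemble `F₃(n, 6n)`;
* `forcedSplits_prob_satisfiable_le` — first moment: `Pr_{F₃(n,6n)}[satisfiable] ≤ 2ⁿ (7/8)^{6n}`;
* `forcedSplits_decay` — `2ⁿ (7/8)^{6n} ≤ n^{-(c+1)}` eventually;
* `forcedSplits_isPolyTimePred_not` — polynomial-time predicates are closed under negation;
* `forcedSplits_nil_not_mem_of_support` — sampled formulas have no empty clause.
-/

set_option linter.dupNamespace false -- `Summit.PneNP.PneNP.…`: summit = sub-problem name (D-0017 single-conjunct layout)

namespace Summit.PneNP.PneNP.Theorems

open Literature.Computability.Complexity Literature.Computability.MetaComplexity Filter Topology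

/-- **Complements**: `Pr[sᶜ] = 1 - Pr[s]` for a `PMF`. [folklore] -/
theorem forcedSplits_toOuterMeasure_compl {α : Type*} (p : PMF α) (s : Set α) : p.toOuterMeasure sᶜ = 1 - p.toOuterMeasure s := by
  classical
  have h : p.toOuterMeasure sᶜ + p.toOuterMeasure s = 1 := by
    rw [PMF.toOuterMeasure_apply, PMF.toOuterMeasure_apply, ← ENNReal.tsum_add, ← p.tsum_coe]
    refine tsum_congr fun x => ?_
    rw [add_comm]
    exact congrFun (Set.indicator_self_add_compl s p) x
  exact ENNReal.eq_sub_of_add_eq (ne_top_of_le_ne_top ENNReal.one_ne_top (Literature.Computability.Cryptography.pmf_toOuterMeasure_apply_le_one p s)) h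

/-- **Marginal of the flow**: an event depending only on the root has the probability of the root ensemble. [folklore] -/
theorem forcedSplits_flow_marginal (q : PMF (CNF ℕ)) (n : ℕ) (P : CNF ℕ → Prop) :
    (q.bind fun φ => (PMF.uniformOfFintype (Equiv.Perm (Fin n) × (Fin n → Bool))).map fun r => (φ, r)).toOuterMeasure
      {ω | P ω.1} = q.toOuterMeasure {φ | P φ} := by
  classical
  rw [PMF.toOuterMeasure_bind_apply, PMF.toOuterMeasure_apply]
  refine tsum_congr fun φ => ?_
  rw [PMF.toOuterMeasure_map_apply]
  by_cases hP : P φ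
  · have e : (fun r : Equiv.Perm (Fin n) × (Fin n → Bool) => (φ, r)) ⁻¹' {ω | P ω.1} = Set.univ := by
      ext r; simp [hP]
    rw [e, (PMF.toOuterMeasure_apply_eq_one_iff _ _).2 (Set.subset_univ _), mul_one, Set.indicator_of_mem (show φ ∈ {φ | P φ} from hP)]
  · have e : (fun r : Equiv.Perm (Fin n) × (Fin n → Bool) => (φ, r)) ⁻¹' {ω | P ω.1} = ∅ := by
      ext r; simp [hP]
    rw [e, MeasureTheory.measure_empty, mul_zero, Set.indicator_of_notMem (show φ ∉ {φ | P φ} from hP)]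

/-- **First moment**: `Pr_{F₃(n, 6n)}[satisfiable] ≤ 2ⁿ (7/8)^{6n}` for `n ≥ 3` (union bound over the `2ⁿ` assignments;
`card_le_of_forall_satisfiable`). [cite: Feige2002, §1] [folklore] -/
theorem forcedSplits_prob_satisfiable_le {n : ℕ} (hn : 3 ≤ n) :
    (randomKCNF 3 n (6 * n)).toOuterMeasure {φ | φ.Satisfiable} ≤ ENNReal.ofReal (2 ^ n * (7 / 8 : ℝ) ^ (6 * n)) := by
  classical
  have hK : (kClauses 3 n).card = n.choose 3 * 8 := by rw [card_kClauses]; norm_num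
  have hne : (kClauses 3 n).Nonempty := by
    rw [← Finset.card_pos, hK]
    exact Nat.mul_pos (Nat.choose_pos hn) (by norm_num)
  set B : Finset (Fin (6 * n) → ↥(kClauses 3 n)) := Finset.univ.filter fun c => CNF.Satisfiable (List.ofFn fun i => (c i : Clause ℕ)) with hB
  have hβ : (0 : ℝ) ≤ 2 ^ n * (7 / 8 : ℝ) ^ (6 * n) := by positivity
  have hlow := randomKCNF_toOuterMeasure_ge hne (E := {φ | ¬ φ.Satisfiable}) hβ B (fun c hc => by
      simp only [hB, Finset.mem_filter, Finset.mem_univ, true_and] at hc; exact hc) (by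
      have h1 := card_le_of_forall_satisfiable B (fun c hc => by simp only [hB, Finset.mem_filter] at hc; exact hc.2)
      have h1' : B.card ≤ 2 ^ n * (n.choose 3 * 7) ^ (6 * n) := by simpa using h1
      have h2 : (B.card : ℝ) ≤ 2 ^ n * ((n.choose 3 : ℝ) * 7) ^ (6 * n) := by exact_mod_cast h1'
      have e : ((7 / 8 : ℝ) * 8) ^ (6 * n) = 7 ^ (6 * n) := by norm_num
      refine h2.trans (le_of_eq ?_)
      rw [hK]; push_cast
      rw [mul_pow, mul_pow, ← e, mul_pow]; ring)
  have hcompl : ({φ : CNF ℕ | φ.Satisfiable} : Set (CNF ℕ)) = {φ | ¬ φ.Satisfiable}ᶜ := by ext φ; simp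
  rw [hcompl, forcedSplits_toOuterMeasure_compl]
  calc (1 : ENNReal) - (randomKCNF 3 n (6 * n)).toOuterMeasure {φ | ¬ φ.Satisfiable}
      ≤ 1 - (1 - ENNReal.ofReal (2 ^ n * (7 / 8 : ℝ) ^ (6 * n))) := tsub_le_tsub_left hlow _
    _ ≤ ENNReal.ofReal (2 ^ n * (7 / 8 : ℝ) ^ (6 * n)) := tsub_tsub_le_tsub_add.trans (by simp)

/-- **Exponential beats polynomial**: `2ⁿ (7/8)^{6n} ≤ n^{-(c+1)}` for all large `n`. [folklore] -/
theorem forcedSplits_decay (c : ℕ) : ∀ᶠ n : ℕ in atTop, ENNReal.ofReal (2 ^ n * (7 / 8 : ℝ) ^ (6 * n)) ≤ ((n : ENNReal)⁻¹) ^ (c + 1) := by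
  have hρ : |(2 * (7 / 8 : ℝ) ^ 6)| < 1 := by rw [abs_of_nonneg (by positivity)]; norm_num
  have ht := tendsto_pow_const_mul_const_pow_of_abs_lt_one (c + 1) hρ
  have hev := ht.eventually (gt_mem_nhds (show (0 : ℝ) < 1 from one_pos))
  filter_upwards [hev, eventually_ge_atTop 1] with n hn hn1
  have hnpos : (0 : ℝ) < n := by exact_mod_cast hn1
  have e : (2 : ℝ) ^ n * (7 / 8 : ℝ) ^ (6 * n) = (2 * (7 / 8 : ℝ) ^ 6) ^ n := by rw [mul_pow, ← pow_mul, mul_comm 6 n]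
  have hle : (2 : ℝ) ^ n * (7 / 8 : ℝ) ^ (6 * n) ≤ ((n : ℝ)⁻¹) ^ (c + 1) := by
    rw [e, inv_pow, ← one_div, le_div_iff₀ (by positivity), mul_comm]
    exact hn.le
  calc ENNReal.ofReal (2 ^ n * (7 / 8 : ℝ) ^ (6 * n)) ≤ ENNReal.ofReal (((n : ℝ)⁻¹) ^ (c + 1)) := ENNReal.ofReal_le_ofReal hle
    _ = ((n : ENNReal)⁻¹) ^ (c + 1) := by
        rw [ENNReal.ofReal_pow (by positivity), ENNReal.ofReal_inv_of_pos hnpos, ENNReal.ofReal_natCast]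

/-- **Polynomial-time predicates are closed under negation** (through the model bridge `P_bool_eq_holds` and
`compl_mem_P_iff`). [cite: AroraBarak2009, §2.6.1 (P = coP)] -/
theorem forcedSplits_isPolyTimePred_not {f : List Bool → Bool} (hf : IsPolyTimePred f) : IsPolyTimePred fun x => !f x := by
  have hL : ({w | f w = true} : Language Bool) ∈ PNPWave0.P Bool := ⟨f, hf, fun _ => Iff.rfl⟩
  have hb : PNPWave0.P Bool = Classes.P := P_bool_eq_holds
  rw [hb] at hL
  have hc := compl_mem_P_iff.2 hL
  rw [← hb] at hc
  obtain ⟨f', hf', hiff⟩ := hc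
  have e : f' = fun x => !f x := by
    funext w
    have h := hiff w
    change ¬ (f w = true) ↔ f' w = true at h
    cases hfw : f w <;> cases hf'w : f' w <;> simp_all
  exact e ▸ hf'

/-- Sampled formulas have no empty clause (for `n ≥ 3` every clause has length `3`; for `n < 3` the formula is empty).
[folklore] -/
theorem forcedSplits_nil_not_mem_of_support {n m : ℕ} {φ : CNF ℕ} (hφ : φ ∈ (randomKCNF 3 n m).support) :
    ([] : Clause ℕ) ∉ φ := fun h => by
  have hl := length_of_mem_kClauses (forall_mem_of_mem_support_randomKCNF hφ [] h)
  exact absurd hl (by norm_num)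

end Summit.PneNP.PneNP.Theorems
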